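import Literature.Analysis.FluidPDE.HardSphereBoundaryFluxEq
import Literature.MathematicalPhysics.KineticTheory.HardSphereMildBBGKYFlux
import HarnessLib

/-!
# The flux formula for the BACKWARD free flight of an incoming adjoined configuration
(Cercignani–Illner–Pulvirenti 1994 App. 4.A (the velocity flip `T^{-t} = S T^t S`, (2.3)) and
App. 4.B; trunk T-KINETIC, topic MathematicalPhysics/KineticTheory; step C3b of the plan for the
one-step mild BBGKY hierarchy almost everywhere, input (H1) of `hs_seriesFamily_ae_eq_of_oneStep`.)

In the window analysis of the derivation of the BBGKY hierarchy, a datum `z` whose orbit has one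
tagged–untagged collision at time `τ` in the window is the BACKWARD free flight
`z = S_{-τ} w_in` of the INCOMING contact configuration `w_in = gainConfig Z' i ν v` (partner
`i` and adjoined sphere carrying the pre-collisional velocities; `Z'`, `v` the outgoing data).
`HardSphereBoundaryFluxEq.lintegral_eq_boundaryFlux_contact` computes Lebesgue integrals in the
coordinates of the FORWARD free flight of OUTGOING contact configurations. This file transfers it:
the velocity flip turns `S_{-τ} (gainConfig Z' i ν v)` into `flipVel (S_τ (lossConfig Z'' i ν w))`
with `(Z'', w)` the flipped scattered parameters (`flipVel_gainConfig_eq`), the map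
`(Z', v) ↦ (Z'', w)` preserves Lebesgue measure (`measurePreserving_flipScatter`:
`measurePreserving_scatterParams`, `measurePreserving_flipVel`), the outgoing flux is unchanged,
and the flip preserves the measure of `(s+1)`-configurations; whence
`lintegral_eq_boundaryFlux_backward`:
`∫ g dZ_{s+1} = ∫ dZ' dv dσ(ν) dτ 1_{⟪v-v_i,ν⟫>0} ε^{d-1}⟪v-v_i,ν⟫ 1_{chart} g(S_{-τ}(gainConfig Z' i ν v))`
for `g` vanishing off the (flipped) chart image of the collision cylinder.

## References

* C. Cercignani, R. Illner, M. Pulvirenti, *The Mathematical Theory of Dilute Gases*, Springer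
  (1994), §4.2 (2.3), App. 4.A pp. 108–111, App. 4.B.
-/

open MeasureTheory MeasureTheory.Measure Metric Real Set Filter Function
open scoped ENNReal InnerProductSpace
open Literature.Analysis.FluidPDE

namespace Literature.MathematicalPhysics.KineticTheory

noncomputable section

section Kinetic

variable {d : Type*} [Fintype d]

/-! ## §1. The velocity flip of an incoming adjoined configuration -/

/-- **The velocity flip of the incoming adjoined configuration is an outgoing loss
configuration** of the flipped scattered parameters:
`flipVel (gainConfig Z' i ν v) = lossConfig (flipVel Z*) i ν (-v*)`,
`(Z*, v*) = scatterParams i ν (Z', v)`. [folklore] -/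
theorem flipVel_gainConfig_eq {X : Type*} (G : Geometry d X) (ε : ℝ) {s : ℕ} (i : Fin (s + 1))
    (ν : sphere (0 : EuclideanSpace ℝ d) 1) (Z' : Config (s + 1) d X) (v : EuclideanSpace ℝ d) :
    flipVel (gainConfig G ε Z' i ν v) =
      lossConfig G ε (flipVel (scatterParams i ν (Z', v)).1) i ν (-(scatterParams i ν (Z', v)).2) := by
  funext j
  refine Fin.addCases (fun j => ?_) (fun j => ?_) j
  · rw [flipVel_apply, lossConfig_apply_castAdd, flipVel_apply, gainConfig_apply_castAdd]
    by_cases hj : j = i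
    · subst hj
      simp [scatterParams, reflectVel_eq_collide]
    · simp [scatterParams, Function.update_of_ne hj]
  · obtain rfl : j = 0 := Subsingleton.elim _ _
    rw [flipVel_apply, lossConfig_apply_last, gainConfig_apply_last, flipVel_apply]
    simp [scatterParams, reflectVel_eq_collide]

/-- The backward free flight of the incoming adjoined configuration is the flip of the forward
free flight of the flipped one. [folklore] -/
theorem freeFlight_neg_gainConfig_eq {X : Type*} (G : Geometry d X) (ε : ℝ) {s : ℕ} (i : Fin (s + 1))
    (ν : sphere (0 : EuclideanSpace ℝ d) 1) (Z' : Config (s + 1) d X) (v : EuclideanSpace ℝ d) (τ : ℝ) :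
    freeFlight G (-τ) (gainConfig G ε Z' i ν v) =
      flipVel (freeFlight G τ (lossConfig G ε (flipVel (scatterParams i ν (Z', v)).1) i ν (-(scatterParams i ν (Z', v)).2))) := by
  rw [← flipVel_gainConfig_eq, Alexander.flipVel_freeFlight_flipVel]

/-- The relative velocity of the flipped scattered parameters has the outgoing flux of the
original ones: `⟪(-v*) - (-v_i*), ν⟫ = ⟪v - v_i, ν⟫`. [folklore] -/
theorem inner_flipScatter {X : Type*} {s : ℕ} (i : Fin (s + 1)) (ν : sphere (0 : EuclideanSpace ℝ d) 1)
    (Z' : Config (s + 1) d X) (v : EuclideanSpace ℝ d) :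
    ⟪-(scatterParams i ν (Z', v)).2 - (flipVel (scatterParams i ν (Z', v)).1 i).2, (ν : EuclideanSpace ℝ d)⟫_ℝ =
      ⟪v - (Z' i).2, (ν : EuclideanSpace ℝ d)⟫_ℝ := by
  rw [flipVel_apply]
  have h := inner_scatterParams (X := X) i ν Z' v
  have : -(scatterParams i ν (Z', v)).2 - -((scatterParams i ν (Z', v)).1 i).2 =
      -((scatterParams i ν (Z', v)).2 - ((scatterParams i ν (Z', v)).1 i).2) := by abel
  rw [this, inner_neg_left, h, neg_neg]

/-- The flipped scattering of the parameters `(Z', v) ↦ (flipVel Z*, -v*)` preserves Lebesgue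
measure. [folklore] -/
theorem measurePreserving_flipScatter {s : ℕ} (i : Fin (s + 1)) (ν : sphere (0 : EuclideanSpace ℝ d) 1) :
    MeasurePreserving (fun p : Config (s + 1) d (UnitAddTorus d) × EuclideanSpace ℝ d =>
        ((flipVel (scatterParams i ν p).1, -(scatterParams i ν p).2) : Config (s + 1) d (UnitAddTorus d) × EuclideanSpace ℝ d))
      ((volume : Measure (Config (s + 1) d (UnitAddTorus d))).prod volume)
      ((volume : Measure (Config (s + 1) d (UnitAddTorus d))).prod volume) := by
  haveI hXE : SigmaFinite (volume : Measure (UnitAddTorus d × EuclideanSpace ℝ d)) := inferInstance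
  haveI hC : SigmaFinite (volume : Measure (Config (s + 1) d (UnitAddTorus d))) := inferInstance
  have hN : MeasurePreserving (fun p : Config (s + 1) d (UnitAddTorus d) × EuclideanSpace ℝ d => ((flipVel p.1, -p.2) :
      Config (s + 1) d (UnitAddTorus d) × EuclideanSpace ℝ d))
      ((volume : Measure (Config (s + 1) d (UnitAddTorus d))).prod volume)
      ((volume : Measure (Config (s + 1) d (UnitAddTorus d))).prod volume) :=
    (measurePreserving_flipVel (X := UnitAddTorus d) (N := s + 1)).prod (Measure.measurePreserving_neg volume)
  exact hN.comp (measurePreserving_scatterParams (X := UnitAddTorus d) i ν)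

/-! ## §2. Iterated integrals over the collision parameters -/

/-- Iterated integrals `∫ dZ ∫ dv ∫ dσ(ν) ∫_{τ>0}` as an integral over the parameters `(ν, τ)` of
integrals over `(Z, v)` (Tonelli). [folklore] -/
theorem lintegral_collisionParams_swap {s : ℕ}
    (F : (Config s d (UnitAddTorus d) × EuclideanSpace ℝ d) × (sphere (0 : EuclideanSpace ℝ d) 1 × ℝ) → ℝ≥0∞)
    (hF : Measurable F) :
    ∫⁻ Z : Config s d (UnitAddTorus d), ∫⁻ v : EuclideanSpace ℝ d, ∫⁻ ν : sphere (0 : EuclideanSpace ℝ d) 1, ∫⁻ τ in Ioi (0 : ℝ),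
        F ((Z, v), (ν, τ)) ∂volume ∂(volume : Measure (EuclideanSpace ℝ d)).toSphere =
      ∫⁻ q, ∫⁻ x, F (x, q) ∂((volume : Measure (Config s d (UnitAddTorus d))).prod (volume : Measure (EuclideanSpace ℝ d)))
        ∂(((volume : Measure (EuclideanSpace ℝ d)).toSphere).prod ((volume : Measure ℝ).restrict (Ioi 0))) := by
  haveI hXE : SigmaFinite (volume : Measure (UnitAddTorus d × EuclideanSpace ℝ d)) := inferInstance
  haveI hC : SigmaFinite (volume : Measure (Config s d (UnitAddTorus d))) := inferInstance
  haveI hσf : IsFiniteMeasure ((volume : Measure (EuclideanSpace ℝ d)).toSphere) := inferInstance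
  haveI hσp : SFinite (((volume : Measure (EuclideanSpace ℝ d)).toSphere).prod ((volume : Measure ℝ).restrict (Ioi 0))) :=
    inferInstance
  -- inner two integrals as an integral over `(ν, τ)`
  have h1 : ∀ (Z : Config s d (UnitAddTorus d)) (v : EuclideanSpace ℝ d),
      ∫⁻ ν : sphere (0 : EuclideanSpace ℝ d) 1, ∫⁻ τ in Ioi (0 : ℝ), F ((Z, v), (ν, τ)) ∂volume
          ∂(volume : Measure (EuclideanSpace ℝ d)).toSphere =
        ∫⁻ q, F ((Z, v), q) ∂(((volume : Measure (EuclideanSpace ℝ d)).toSphere).prod ((volume : Measure ℝ).restrict (Ioi 0))) := by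
    intro Z v
    rw [lintegral_prod (fun q : sphere (0 : EuclideanSpace ℝ d) 1 × ℝ => F ((Z, v), q))
      ((hF.comp (measurable_const.prodMk measurable_id)).aemeasurable)]
  simp_rw [h1]
  -- outer two integrals as an integral over `(Z, v)`
  have h2 : ∫⁻ Z : Config s d (UnitAddTorus d), ∫⁻ v : EuclideanSpace ℝ d,
      ∫⁻ q, F ((Z, v), q) ∂(((volume : Measure (EuclideanSpace ℝ d)).toSphere).prod ((volume : Measure ℝ).restrict (Ioi 0))) =
      ∫⁻ x, ∫⁻ q, F (x, q) ∂(((volume : Measure (EuclideanSpace ℝ d)).toSphere).prod ((volume : Measure ℝ).restrict (Ioi 0)))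
        ∂((volume : Measure (Config s d (UnitAddTorus d))).prod (volume : Measure (EuclideanSpace ℝ d))) := by
    rw [lintegral_prod (fun x : Config s d (UnitAddTorus d) × EuclideanSpace ℝ d =>
      ∫⁻ q, F (x, q) ∂(((volume : Measure (EuclideanSpace ℝ d)).toSphere).prod ((volume : Measure ℝ).restrict (Ioi 0))))
      (hF.lintegral_prod_right'.aemeasurable)]
  rw [h2]
  exact lintegral_lintegral_swap hF.aemeasurable

/-! ## §3. The flux formula for the backward free flight of incoming adjoined configurations -/

/-- **The flux formula, backward from incoming adjoined configurations.** For `s + 1` spheres on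
`T^d`, a label `i`, `ε > 0`, a chart radius `ρ < 1/2` and measurable `g ≥ 0` on
`Config (s + 2)` vanishing at every FLIPPED configuration `flipVel (appendParticle W' (x'_i + proj r) w)`
with `r` in the cube outside `B̄(0, ρ) ∩ Cyl_ε(w - v'_i)`:
`∫ g dZ = ∫ dZ' ∫ dv ∫ dσ(ν) ∫_{τ>0} 1_{⟪v-v_i,ν⟫>0} ε^{d-1}⟪v - v_i, ν⟫
  1_{‖εν - τ(v* - v_i*)‖ ≤ ρ} g (S_{-τ} (gainConfig Z' i ν v))`,
`(v_i*, v*) = collide ν (v_i, v)` the incoming velocities — the data whose forward free flight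
meets, at time `τ`, the tagged sphere `i` with outgoing data `(Z', v)`. [cite: CIP1994, App. 4.A pp. 108–111] -/
theorem lintegral_eq_boundaryFlux_backward [Nonempty d] {s : ℕ} (i : Fin (s + 1)) {ε : ℝ} (hε : 0 < ε) {ρ : ℝ} (hρ : ρ < 1 / 2)
    (g : Config (s + 1 + 1) d (UnitAddTorus d) → ℝ≥0∞) (hg : Measurable g)
    (hg0 : ∀ (W' : Config (s + 1) d (UnitAddTorus d)) (w : EuclideanSpace ℝ d) (r : EuclideanSpace ℝ d),
      r ∈ Torus.symCube d → r ∉ closedBall (0 : EuclideanSpace ℝ d) ρ ∩ collisionCylRegion ε (w - (W' i).2) →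
        g (flipVel (appendParticle W' ((W' i).1 + Literature.Analysis.FunctionSpaces.Torus.proj r) w)) = 0) :
    ∫⁻ Z' : Config (s + 1) d (UnitAddTorus d), ∫⁻ v : EuclideanSpace ℝ d,
        ∫⁻ ν : sphere (0 : EuclideanSpace ℝ d) 1, ∫⁻ τ in Ioi (0 : ℝ),
          (collisionCylDom (v - (Z' i).2)).indicator (fun _ => (1 : ℝ≥0∞)) (ν : EuclideanSpace ℝ d) *
            (ENNReal.ofReal (ε ^ (Fintype.card d - 1) * ⟪v - (Z' i).2, (ν : EuclideanSpace ℝ d)⟫_ℝ) *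
              ((closedBall (0 : EuclideanSpace ℝ d) ρ).indicator
                (fun _ => g (freeFlight (Torus.geometry d) (-τ) (gainConfig (Torus.geometry d) ε Z' i ν v)))
                (ε • (ν : EuclideanSpace ℝ d) -
                  τ • ((collide ν ((Z' i).2, v)).2 - (collide ν ((Z' i).2, v)).1))))
          ∂volume ∂(volume : Measure (EuclideanSpace ℝ d)).toSphere =
      ∫⁻ W, g W := by
  haveI hXE : SigmaFinite (volume : Measure (UnitAddTorus d × EuclideanSpace ℝ d)) := inferInstance
  haveI hC : SigmaFinite (volume : Measure (Config (s + 1) d (UnitAddTorus d))) := inferInstance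
  -- the forward integrand, in contact-time coordinates, for `g ∘ flipVel`
  set Φ : (Config (s + 1) d (UnitAddTorus d) × EuclideanSpace ℝ d) × (sphere (0 : EuclideanSpace ℝ d) 1 × ℝ) → ℝ≥0∞ :=
    fun p => (collisionCylDom (p.1.2 - (p.1.1 i).2)).indicator (fun _ => (1 : ℝ≥0∞)) (p.2.1 : EuclideanSpace ℝ d) *
      (ENNReal.ofReal (ε ^ (Fintype.card d - 1) * ⟪p.1.2 - (p.1.1 i).2, (p.2.1 : EuclideanSpace ℝ d)⟫_ℝ) *
        ((closedBall (0 : EuclideanSpace ℝ d) ρ).indicator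
          (fun _ => g (flipVel (freeFlight (Torus.geometry d) p.2.2 (lossConfig (Torus.geometry d) ε p.1.1 i p.2.1 p.1.2))))
          (ε • (p.2.1 : EuclideanSpace ℝ d) + p.2.2 • (p.1.2 - (p.1.1 i).2)))) with hΦ
  -- the backward integrand
  set Ψ : (Config (s + 1) d (UnitAddTorus d) × EuclideanSpace ℝ d) × (sphere (0 : EuclideanSpace ℝ d) 1 × ℝ) → ℝ≥0∞ :=
    fun p => (collisionCylDom (p.1.2 - (p.1.1 i).2)).indicator (fun _ => (1 : ℝ≥0∞)) (p.2.1 : EuclideanSpace ℝ d) *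
      (ENNReal.ofReal (ε ^ (Fintype.card d - 1) * ⟪p.1.2 - (p.1.1 i).2, (p.2.1 : EuclideanSpace ℝ d)⟫_ℝ) *
        ((closedBall (0 : EuclideanSpace ℝ d) ρ).indicator
          (fun _ => g (freeFlight (Torus.geometry d) (-p.2.2) (gainConfig (Torus.geometry d) ε p.1.1 i p.2.1 p.1.2)))
          (ε • (p.2.1 : EuclideanSpace ℝ d) -
            p.2.2 • ((collide p.2.1 ((p.1.1 i).2, p.1.2)).2 - (collide p.2.1 ((p.1.1 i).2, p.1.2)).1)))) with hΨ
  -- the flipped scattering turns `Ψ` into `Φ`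
  have hΨΦ : ∀ p, Ψ p = Φ (((flipVel (scatterParams i p.2.1 p.1).1, -(scatterParams i p.2.1 p.1).2) :
      Config (s + 1) d (UnitAddTorus d) × EuclideanSpace ℝ d), p.2) := by
    rintro ⟨⟨Z', v⟩, ⟨ν, τ⟩⟩
    have hsp : scatterParams i ν (Z', v) =
        (Function.update Z' i ((Z' i).1, (collide ν ((Z' i).2, v)).1), (collide ν ((Z' i).2, v)).2) := rfl
    -- the relative velocity of the flipped scattered parameters
    have hu : -(scatterParams i ν (Z', v)).2 - (flipVel (scatterParams i ν (Z', v)).1 i).2 =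
        -((collide ν ((Z' i).2, v)).2 - (collide ν ((Z' i).2, v)).1) := by
      rw [flipVel_apply, hsp]
      simp only [Function.update_self]
      abel
    -- its flux is the outgoing flux
    have hflux : ⟪-((collide ν ((Z' i).2, v)).2 - (collide ν ((Z' i).2, v)).1), (ν : EuclideanSpace ℝ d)⟫_ℝ =
        ⟪v - (Z' i).2, (ν : EuclideanSpace ℝ d)⟫_ℝ := by
      have h := inner_scatterParams (X := UnitAddTorus d) i ν Z' v
      rw [hsp] at h
      simp only [Function.update_self] at h
      rw [inner_neg_left, h, neg_neg]
    -- the three factors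
    have h1 : (collisionCylDom (-((collide ν ((Z' i).2, v)).2 - (collide ν ((Z' i).2, v)).1))).indicator
        (fun _ => (1 : ℝ≥0∞)) (ν : EuclideanSpace ℝ d) =
        (collisionCylDom (v - (Z' i).2)).indicator (fun _ => (1 : ℝ≥0∞)) (ν : EuclideanSpace ℝ d) := by
      by_cases h : 0 < ⟪v - (Z' i).2, (ν : EuclideanSpace ℝ d)⟫_ℝ
      · rw [indicator_of_mem (show (ν : EuclideanSpace ℝ d) ∈ collisionCylDom (v - (Z' i).2) from h),
          indicator_of_mem]
        rw [mem_collisionCylDom, hflux]; exact h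
      · rw [indicator_of_notMem (show (ν : EuclideanSpace ℝ d) ∉ collisionCylDom (v - (Z' i).2) from h),
          indicator_of_notMem]
        rw [mem_collisionCylDom, hflux]; exact h
    have h3 : ε • (ν : EuclideanSpace ℝ d) + τ • (-((collide ν ((Z' i).2, v)).2 - (collide ν ((Z' i).2, v)).1)) =
        ε • (ν : EuclideanSpace ℝ d) - τ • ((collide ν ((Z' i).2, v)).2 - (collide ν ((Z' i).2, v)).1) := by
      rw [smul_neg, ← sub_eq_add_neg]
    simp only [hΨ, hΦ]
    rw [hu, hflux, h1, h3, freeFlight_neg_gainConfig_eq]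
  -- measurability
  have hGm := Torus.isMeasurable_geometry (d := d)
  have hZ : Measurable fun p : (Config (s + 1) d (UnitAddTorus d) × EuclideanSpace ℝ d) × (sphere (0 : EuclideanSpace ℝ d) 1 × ℝ) =>
      p.1.1 := measurable_fst.fst
  have hv : Measurable fun p : (Config (s + 1) d (UnitAddTorus d) × EuclideanSpace ℝ d) × (sphere (0 : EuclideanSpace ℝ d) 1 × ℝ) =>
      p.1.2 := measurable_fst.snd
  have hν : Measurable fun p : (Config (s + 1) d (UnitAddTorus d) × EuclideanSpace ℝ d) × (sphere (0 : EuclideanSpace ℝ d) 1 × ℝ) =>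
      (p.2.1 : EuclideanSpace ℝ d) := measurable_subtype_coe.comp measurable_snd.fst
  have hτ : Measurable fun p : (Config (s + 1) d (UnitAddTorus d) × EuclideanSpace ℝ d) × (sphere (0 : EuclideanSpace ℝ d) 1 × ℝ) =>
      p.2.2 := measurable_snd.snd
  have hvi : Measurable fun p : (Config (s + 1) d (UnitAddTorus d) × EuclideanSpace ℝ d) × (sphere (0 : EuclideanSpace ℝ d) 1 × ℝ) =>
      (p.1.1 i).2 := ((measurable_pi_apply i).comp hZ).snd
  have hu : Measurable fun p : (Config (s + 1) d (UnitAddTorus d) × EuclideanSpace ℝ d) × (sphere (0 : EuclideanSpace ℝ d) 1 × ℝ) =>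
      p.1.2 - (p.1.1 i).2 := hv.sub hvi
  have hdomI : ∀ (uf : (Config (s + 1) d (UnitAddTorus d) × EuclideanSpace ℝ d) × (sphere (0 : EuclideanSpace ℝ d) 1 × ℝ) → EuclideanSpace ℝ d),
      Measurable uf → Measurable fun p => (collisionCylDom (uf p)).indicator (fun _ => (1 : ℝ≥0∞)) (p.2.1 : EuclideanSpace ℝ d) := by
    intro uf huf
    have hset : MeasurableSet {p : (Config (s + 1) d (UnitAddTorus d) × EuclideanSpace ℝ d) × (sphere (0 : EuclideanSpace ℝ d) 1 × ℝ) |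
        0 < ⟪uf p, (p.2.1 : EuclideanSpace ℝ d)⟫_ℝ} := measurableSet_lt measurable_const (huf.inner hν)
    have heq : (fun p : (Config (s + 1) d (UnitAddTorus d) × EuclideanSpace ℝ d) × (sphere (0 : EuclideanSpace ℝ d) 1 × ℝ) =>
        (collisionCylDom (uf p)).indicator (fun _ => (1 : ℝ≥0∞)) (p.2.1 : EuclideanSpace ℝ d)) =
        {p | 0 < ⟪uf p, (p.2.1 : EuclideanSpace ℝ d)⟫_ℝ}.indicator (fun _ => (1 : ℝ≥0∞)) := by
      funext p
      by_cases h : 0 < ⟪uf p, (p.2.1 : EuclideanSpace ℝ d)⟫_ℝ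
      · rw [indicator_of_mem (show (p.2.1 : EuclideanSpace ℝ d) ∈ collisionCylDom (uf p) from h),
          indicator_of_mem (show p ∈ {p : (Config (s + 1) d (UnitAddTorus d) × EuclideanSpace ℝ d) ×
            (sphere (0 : EuclideanSpace ℝ d) 1 × ℝ) | 0 < ⟪uf p, (p.2.1 : EuclideanSpace ℝ d)⟫_ℝ} from h)]
      · rw [indicator_of_notMem (show (p.2.1 : EuclideanSpace ℝ d) ∉ collisionCylDom (uf p) from h),
          indicator_of_notMem (show p ∉ {p : (Config (s + 1) d (UnitAddTorus d) × EuclideanSpace ℝ d) ×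
            (sphere (0 : EuclideanSpace ℝ d) 1 × ℝ) | 0 < ⟪uf p, (p.2.1 : EuclideanSpace ℝ d)⟫_ℝ} from h)]
    rw [heq]
    exact measurable_const.indicator hset
  have hballI : ∀ (G0 : (Config (s + 1) d (UnitAddTorus d) × EuclideanSpace ℝ d) × (sphere (0 : EuclideanSpace ℝ d) 1 × ℝ) → ℝ≥0∞)
      (rf : (Config (s + 1) d (UnitAddTorus d) × EuclideanSpace ℝ d) × (sphere (0 : EuclideanSpace ℝ d) 1 × ℝ) → EuclideanSpace ℝ d),
      Measurable G0 → Measurable rf →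
      Measurable fun p => (closedBall (0 : EuclideanSpace ℝ d) ρ).indicator (fun _ => G0 p) (rf p) := by
    classical
    intro G0 rf hG0 hrf
    have heq : (fun p => (closedBall (0 : EuclideanSpace ℝ d) ρ).indicator (fun _ => G0 p) (rf p)) =
        fun p => if rf p ∈ closedBall (0 : EuclideanSpace ℝ d) ρ then G0 p else 0 := by
      funext p
      by_cases h : rf p ∈ closedBall (0 : EuclideanSpace ℝ d) ρ
      · rw [indicator_of_mem h, if_pos h]
      · rw [indicator_of_notMem h, if_neg h]
    rw [heq]
    exact Measurable.ite (measurableSet_closedBall.preimage hrf) hG0 measurable_const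
  have hcol : Measurable fun p : (Config (s + 1) d (UnitAddTorus d) × EuclideanSpace ℝ d) × (sphere (0 : EuclideanSpace ℝ d) 1 × ℝ) =>
      collide p.2.1 ((p.1.1 i).2, p.1.2) := by
    have hc : Measurable fun q : EuclideanSpace ℝ d × (EuclideanSpace ℝ d × EuclideanSpace ℝ d) =>
        (q.2.1 - ⟪q.2.1 - q.2.2, q.1⟫_ℝ • q.1, q.2.2 + ⟪q.2.1 - q.2.2, q.1⟫_ℝ • q.1) := by fun_prop
    exact hc.comp (hν.prodMk (hvi.prodMk hv))
  have hΦm : Measurable Φ := by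
    rw [hΦ]
    refine (hdomI _ hu).mul (((measurable_const.mul (hu.inner hν)).ennreal_ofReal).mul (hballI _ _ ?_ ?_))
    · exact (hg.comp measurable_flipVel).comp (hGm.measurable_freeFlight₂.comp
        (hτ.prodMk (measurable_lossConfig hGm.measurable_translate ε i hZ hν hv)))
    · exact (hν.const_smul ε).add (hτ.smul hu)
  have hΨm : Measurable Ψ := by
    rw [hΨ]
    refine (hdomI _ hu).mul (((measurable_const.mul (hu.inner hν)).ennreal_ofReal).mul (hballI _ _ ?_ ?_))
    · exact hg.comp (hGm.measurable_freeFlight₂.comp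
        (hτ.neg.prodMk (measurable_gainConfig hGm.measurable_translate ε i hZ hν hv)))
    · exact (hν.const_smul ε).sub (hτ.smul (hcol.snd.sub hcol.fst))
  -- the chain
  have hT : ∀ ν : sphere (0 : EuclideanSpace ℝ d) 1, Measurable fun x : Config (s + 1) d (UnitAddTorus d) × EuclideanSpace ℝ d =>
      ((flipVel (scatterParams i ν x).1, -(scatterParams i ν x).2) : Config (s + 1) d (UnitAddTorus d) × EuclideanSpace ℝ d) :=
    fun ν => (measurePreserving_flipScatter (d := d) i ν).measurable
  have step1 : (∫⁻ Z' : Config (s + 1) d (UnitAddTorus d), ∫⁻ v : EuclideanSpace ℝ d,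
        ∫⁻ ν : sphere (0 : EuclideanSpace ℝ d) 1, ∫⁻ τ in Ioi (0 : ℝ), Ψ ((Z', v), (ν, τ))
          ∂volume ∂(volume : Measure (EuclideanSpace ℝ d)).toSphere) =
      ∫⁻ Z' : Config (s + 1) d (UnitAddTorus d), ∫⁻ v : EuclideanSpace ℝ d,
        ∫⁻ ν : sphere (0 : EuclideanSpace ℝ d) 1, ∫⁻ τ in Ioi (0 : ℝ), Φ ((Z', v), (ν, τ))
          ∂volume ∂(volume : Measure (EuclideanSpace ℝ d)).toSphere := by
    rw [lintegral_collisionParams_swap Ψ hΨm, lintegral_collisionParams_swap Φ hΦm]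
    refine lintegral_congr fun q => ?_
    have hq : Measurable fun y : Config (s + 1) d (UnitAddTorus d) × EuclideanSpace ℝ d => Φ (y, q) :=
      hΦm.comp (measurable_id.prodMk measurable_const)
    rw [← (measurePreserving_flipScatter (d := d) i q.1).lintegral_comp hq]
    exact lintegral_congr fun x => hΨΦ (x, q)
  have key := lintegral_eq_boundaryFlux_contact i hε hρ (g ∘ flipVel) (hg.comp measurable_flipVel)
    (fun W' w r hr hrS => hg0 W' w r hr hrS)
  have hflip : ∫⁻ W, (g ∘ flipVel) W = ∫⁻ W, g W :=
    (measurePreserving_flipVel (X := UnitAddTorus d) (N := s + 1 + 1)).lintegral_comp hg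
  calc _ = ∫⁻ Z' : Config (s + 1) d (UnitAddTorus d), ∫⁻ v : EuclideanSpace ℝ d,
          ∫⁻ ν : sphere (0 : EuclideanSpace ℝ d) 1, ∫⁻ τ in Ioi (0 : ℝ), Ψ ((Z', v), (ν, τ))
            ∂volume ∂(volume : Measure (EuclideanSpace ℝ d)).toSphere := rfl
    _ = _ := step1
    _ = ∫⁻ W, (g ∘ flipVel) W := key
    _ = ∫⁻ W, g W := hflip

end Kinetic

end

end Literature.MathematicalPhysics.KineticTheory
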